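import Literature.NumberTheory.CubicFields.CubicFieldForms
import Mathlib.NumberTheory.NumberField.Discriminant.Basic
import Mathlib.FieldTheory.IsAlgClosed.Basic
import Mathlib.Analysis.Complex.Polynomial.Basic
import HarnessLib

/-!
# The Davenport–Heilbronn counting function `N₃^±(X)` of cubic fields

Topic `Literature/NumberTheory/CubicFields`. Bhargava–Taniguchi–Thorne 2023, display (3) and
§2.1: "`N₃^±(X)` denotes the number of cubic fields `K` (up to isomorphism) with
`0 < ±Disc(K) < X`." This file DEFINES that counting function in Mathlib's language and proves
that it is a well-defined natural number counting exactly the printed objects: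

* `FiniteSubfield` — subfields of `ℂ` finite over `ℚ` (each a `NumberField`);
* `cubicSubfields s X` — those of degree `3` with `0 < s · Disc < X` (`s = ±1`); a FINITE set by
  Hermite's theorem (Mathlib's `NumberField.finite_of_discr_bdd`), `cubicSubfields_finite`;
* `cubicFieldCount s X = N₃^{sgn s}(X)` — the number of ISOMORPHISM CLASSES (`ℚ`-algebra
  isomorphism, equivalently ring isomorphism) of members of `cubicSubfields s X`;
* `exists_mem_cubicSubfields_algEquiv` — **every cubic number field `K` with `0 < s·Disc(K) < X`
  is isomorphic to a member** (embed `K ↪ ℂ`), so `cubicFieldCount` counts all cubic fields up to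
  isomorphism, as printed;
* `cubicFieldCount_mono` — monotone in `X`;
* `orbitOfClass`, `orbitOfClass_injective` — the injection of BTT §2.2 from isomorphism classes of
  cubic fields into `GL₂(ℤ)`-orbits of (irreducible, `Disc = Disc K`) integral binary cubic forms
  (`CubicFieldForms.lean`), through which `N₃(X)` is counted by Davenport–Heilbronn.

NOT here: any asymptotic for `N₃^±(X)` (BTT (3), Thm 1.1) — those are theorems of the paper, not
vendored as facts in this file.

## References

* M. Bhargava, T. Taniguchi, F. Thorne, *Improved error estimates for the Davenport–Heilbronn
  theorems*, Math. Ann. 389 (2024) = arXiv:2107.12819, (3) and §2.1–2.2 [BhargavaTaniguchiThorne2023].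
* H. Davenport, H. Heilbronn, *On the density of discriminants of cubic fields. II*, Proc. Roy.
  Soc. London A 322 (1971) [DavenportHeilbronn1971].
-/

namespace Literature.NumberTheory.CubicFields

open NumberField Module BinaryCubic

/-- Subfields of `ℂ` that are finite over `ℚ` — concrete representatives of number fields. [folklore] -/
abbrev FiniteSubfield : Type := { F : IntermediateField ℚ ℂ // FiniteDimensional ℚ F }

/-- Each finite subfield of `ℂ` is a number field. [folklore] -/
instance (K : FiniteSubfield) : NumberField K := @NumberField.mk _ _ inferInstance K.prop

/-- **The cubic fields with `0 < s · Disc < X`** inside `ℂ` (`s = 1`: positive discriminants,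
`s = −1`: negative discriminants), as in `N₃^±(X)` of BTT 2023, (3). [cite: BhargavaTaniguchiThorne2023, (3) and §2.1 (cubic fields K with 0 < ±Disc(K) < X)] -/
def cubicSubfields (s : ℤ) (X : ℝ) : Set FiniteSubfield :=
  {K | Module.finrank ℚ K = 3 ∧ 0 < s * discr K ∧ ((s * discr K : ℤ) : ℝ) < X}

/-- Membership in `cubicSubfields`. [folklore] -/
theorem mem_cubicSubfields {s : ℤ} {X : ℝ} {K : FiniteSubfield} :
    K ∈ cubicSubfields s X ↔ Module.finrank ℚ K = 3 ∧ 0 < s * discr K ∧ ((s * discr K : ℤ) : ℝ) < X :=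
  Iff.rfl

/-- **Hermite: there are only finitely many cubic subfields of `ℂ` with bounded discriminant**
(Mathlib's `NumberField.finite_of_discr_bdd`), so `N₃^±(X)` is finite. [folklore] -/
theorem cubicSubfields_finite {s : ℤ} (hs : s = 1 ∨ s = -1) (X : ℝ) : (cubicSubfields s X).Finite := by
  refine (NumberField.finite_of_discr_bdd ℂ ⌈X⌉₊).subset ?_
  rintro K ⟨-, h0, hX⟩
  change |discr K| ≤ (⌈X⌉₊ : ℤ)
  have habs : |discr K| = s * discr K := by
    rcases hs with rfl | rfl
    · rw [one_mul] at h0 ⊢; exact abs_of_pos h0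
    · rw [neg_one_mul] at h0 ⊢; exact abs_of_neg (by omega)
  rw [habs]
  have h1 : ((s * discr K : ℤ) : ℝ) ≤ (⌈X⌉₊ : ℝ) := hX.le.trans (Nat.le_ceil X)
  exact_mod_cast h1

/-- The set of cubic subfields with `0 < s·Disc < X` is a finite type. [folklore] -/
instance finite_cubicSubfields (s : ℤ) [Fact (s = 1 ∨ s = -1)] (X : ℝ) : Finite (cubicSubfields s X) :=
  (cubicSubfields_finite (Fact.out : s = 1 ∨ s = -1) X).to_subtype

/-- Isomorphism (as `ℚ`-algebras, i.e. as fields) of finite subfields of `ℂ`. [folklore] -/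
def isoSetoid : Setoid FiniteSubfield where
  r K L := Nonempty (K ≃ₐ[ℚ] L)
  iseqv := ⟨fun _ => ⟨AlgEquiv.refl⟩, fun ⟨e⟩ => ⟨e.symm⟩, fun ⟨e⟩ ⟨e'⟩ => ⟨e.trans e'⟩⟩

/-- The isomorphism classes of cubic fields with `0 < s·Disc < X`. [folklore] -/
def CubicFieldClasses (s : ℤ) (X : ℝ) : Type :=
  Quotient (isoSetoid.comap (Subtype.val : cubicSubfields s X → FiniteSubfield))

/-- There are finitely many isomorphism classes of cubic fields with `0 < s·Disc < X`. [folklore] -/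
instance (s : ℤ) [Fact (s = 1 ∨ s = -1)] (X : ℝ) : Finite (CubicFieldClasses s X) :=
  Quotient.finite _

/-- **`N₃^±(X)`**: the number of cubic fields `K`, up to isomorphism, with `0 < ±Disc(K) < X`
(BTT 2023, (3); `s = 1` gives `N₃⁺`, `s = −1` gives `N₃⁻`) — the cardinality of the set of
isomorphism classes of cubic subfields of `ℂ` with `0 < s·Disc < X` (every cubic number field is
isomorphic to one of these, `exists_mem_cubicSubfields_algEquiv`). [cite: BhargavaTaniguchiThorne2023, (3) (N₃^±(X) = number of cubic fields up to isomorphism with 0 < ±Disc < X)] -/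
noncomputable def cubicFieldCount (s : ℤ) (X : ℝ) : ℕ :=
  Nat.card (CubicFieldClasses s X)

/-- A finite subfield of `ℂ` isomorphic to a cubic number field `K` with `0 < s·Disc(K) < X` lies
in `cubicSubfields s X` (degree and discriminant are isomorphism invariants). [folklore] -/
theorem mem_cubicSubfields_of_algEquiv (K : Type*) [Field K] [NumberField K] (F : FiniteSubfield)
    (e : K ≃ₐ[ℚ] F) (h3 : Module.finrank ℚ K = 3) {s : ℤ} {X : ℝ} (h0 : 0 < s * discr K)
    (hX : ((s * discr K : ℤ) : ℝ) < X) : F ∈ cubicSubfields s X := by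
  have hdisc : discr F = discr K := (NumberField.discr_eq_discr_of_algEquiv K e).symm
  refine ⟨?_, ?_, ?_⟩
  · rw [← h3]; exact (LinearEquiv.finrank_eq e.toLinearEquiv).symm
  · rwa [hdisc]
  · rwa [hdisc]

/-- **Every cubic number field is represented**: a number field `K` of degree `3` with
`0 < s·Disc(K) < X` is isomorphic to a member of `cubicSubfields s X` (embed `K` into the
algebraically closed field `ℂ` and take the image). [folklore] -/
theorem exists_mem_cubicSubfields_algEquiv (K : Type*) [Field K] [NumberField K] (h3 : Module.finrank ℚ K = 3)
    {s : ℤ} {X : ℝ} (h0 : 0 < s * discr K) (hX : ((s * discr K : ℤ) : ℝ) < X) :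
    ∃ F ∈ cubicSubfields s X, Nonempty (K ≃ₐ[ℚ] F) := by
  let φ : K →ₐ[ℚ] ℂ := IsAlgClosed.lift
  let e : K ≃ₐ[ℚ] φ.fieldRange := φ.equivFieldRange
  haveI hfd : FiniteDimensional ℚ φ.fieldRange := LinearEquiv.finiteDimensional e.toLinearEquiv
  exact ⟨⟨φ.fieldRange, hfd⟩, mem_cubicSubfields_of_algEquiv K ⟨φ.fieldRange, hfd⟩ e h3 h0 hX, ⟨e⟩⟩

/-- Conversely every member is a cubic number field with `0 < s·Disc < X` (by definition). [folklore] -/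
theorem finrank_eq_three_of_mem {s : ℤ} {X : ℝ} {K : FiniteSubfield} (hK : K ∈ cubicSubfields s X) :
    Module.finrank ℚ K = 3 := hK.1

/-- `N₃^±` is monotone in `X`. [folklore] -/
theorem cubicFieldCount_mono (s : ℤ) [Fact (s = 1 ∨ s = -1)] {X Y : ℝ} (h : X ≤ Y) :
    cubicFieldCount s X ≤ cubicFieldCount s Y := by
  -- the inclusion of `cubicSubfields s X` into `cubicSubfields s Y` descends to the quotients
  have hsub : cubicSubfields s X ⊆ cubicSubfields s Y := fun K ⟨h1, h2, h3⟩ => ⟨h1, h2, h3.trans_le h⟩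
  let ι : CubicFieldClasses s X → CubicFieldClasses s Y :=
    Quotient.map' (fun K => ⟨K.1, hsub K.2⟩) (fun K L hKL => hKL)
  refine Nat.card_le_card_of_injective ι fun a b hab => ?_
  induction a using Quotient.inductionOn' with | h a => ?_
  induction b using Quotient.inductionOn' with | h b => ?_
  have hab' : (Quotient.mk'' ⟨a.1, hsub a.2⟩ : CubicFieldClasses s Y) = Quotient.mk'' ⟨b.1, hsub b.2⟩ := hab
  have hr : Nonempty ((a : FiniteSubfield) ≃ₐ[ℚ] (b : FiniteSubfield)) := Quotient.exact' hab'
  exact Quotient.sound' hr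

/-! ### Cubic fields ↦ `GL₂(ℤ)`-orbits of forms -/

/-- The `GL₂(ℤ)`-orbit of binary cubic forms attached to a cubic subfield `K` of `ℂ`: the orbit
of any `f` with `R(f) ≅ 𝓞 K` (well defined: `gl2zEquiv_of_ringEquiv_ringOfIntegers`). [folklore] -/
noncomputable def orbitOfField {s : ℤ} {X : ℝ} (K : cubicSubfields s X) : Set (BinaryCubic ℤ) :=
  gl2zOrbit (exists_ringOfForm_ringEquiv_ringOfIntegers (K : FiniteSubfield) K.2.1).choose

/-- The chosen form of `K` has ring `𝓞 K`. [folklore] -/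
theorem nonempty_ringEquiv_chosenForm {s : ℤ} {X : ℝ} (K : cubicSubfields s X) :
    Nonempty (RingOfForm (exists_ringOfForm_ringEquiv_ringOfIntegers (K : FiniteSubfield) K.2.1).choose
      ≃+* 𝓞 (K : FiniteSubfield)) :=
  (exists_ringOfForm_ringEquiv_ringOfIntegers (K : FiniteSubfield) K.2.1).choose_spec

/-- Isomorphic fields have the same orbit. [folklore] -/
theorem orbitOfField_eq_of_algEquiv {s : ℤ} {X : ℝ} {K L : cubicSubfields s X}
    (e : (K : FiniteSubfield) ≃ₐ[ℚ] (L : FiniteSubfield)) : orbitOfField K = orbitOfField L := by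
  obtain ⟨eK⟩ := nonempty_ringEquiv_chosenForm K
  obtain ⟨eL⟩ := nonempty_ringEquiv_chosenForm L
  exact gl2zOrbit_eq_iff.mpr (gl2zEquiv_of_ringEquiv_ringOfIntegers_of_ringEquiv eK eL e.toRingEquiv)

/-- **The map of BTT §2.2: isomorphism classes of cubic fields → `GL₂(ℤ)`-orbits on `V(ℤ)`.** [cite: BhargavaTaniguchiThorne2023, §2.2 (counting cubic fields by counting GL₂(ℤ)-orbits of binary cubic forms)] -/
noncomputable def orbitOfClass {s : ℤ} {X : ℝ} : CubicFieldClasses s X → Set (BinaryCubic ℤ) :=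
  Quotient.lift orbitOfField fun _ _ ⟨e⟩ => orbitOfField_eq_of_algEquiv e

/-- **The map class ↦ orbit is injective** (equivalent forms give isomorphic maximal orders,
hence isomorphic fields). [folklore] -/
theorem orbitOfClass_injective {s : ℤ} {X : ℝ} : Function.Injective (orbitOfClass (s := s) (X := X)) := by
  intro a b hab
  induction a using Quotient.inductionOn with | h K => ?_
  induction b using Quotient.inductionOn with | h L => ?_
  change orbitOfField K = orbitOfField L at hab
  obtain ⟨eK⟩ := nonempty_ringEquiv_chosenForm K
  obtain ⟨eL⟩ := nonempty_ringEquiv_chosenForm L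
  obtain ⟨φ⟩ := nonempty_ringEquiv_of_gl2zEquiv_forms eK eL (gl2zOrbit_eq_iff.mp hab)
  exact Quotient.sound ⟨AlgEquiv.ofRingEquiv (f := φ) fun _ => by simp⟩

/-- Every orbit in the image consists of irreducible forms of discriminant `Disc K`, in particular
with `0 < s·Disc < X`. [folklore] -/
theorem orbitOfField_subset {s : ℤ} {X : ℝ} (K : cubicSubfields s X) :
    orbitOfField K ⊆ {g : BinaryCubic ℤ | g.IsIrreducible ∧ g.disc = discr (K : FiniteSubfield)} := by
  intro g hg
  obtain ⟨eK⟩ := nonempty_ringEquiv_chosenForm K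
  have hg' : GL2ZEquiv _ g := hg
  refine ⟨(hg'.isIrreducible_iff).mp (isIrreducible_of_ringEquiv_ringOfIntegers eK), ?_⟩
  rw [hg'.disc_eq, disc_eq_discr_of_ringEquiv_ringOfIntegers K.2.1 eK]

/-- **`N₃^±(X)` is the number of orbits in the image**: `cubicFieldCount s X` equals the
cardinality of the set of `GL₂(ℤ)`-orbits attached to cubic fields with `0 < s·Disc < X`. [folklore] -/
theorem cubicFieldCount_eq_card_range_orbitOfClass (s : ℤ) [Fact (s = 1 ∨ s = -1)] (X : ℝ) :
    cubicFieldCount s X = Nat.card (Set.range (orbitOfClass (s := s) (X := X))) :=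
  (Nat.card_range_of_injective orbitOfClass_injective).symm

end Literature.NumberTheory.CubicFields
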